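import Literature.AlgebraicGeometry.Deformation.CanonicalRestrictedLiftBaseChangeQuot
import Literature.AlgebraicGeometry.Deformation.SmoothLiftAtlasVocabularyQuot
import Literature.AlgebraicGeometry.Deformation.SmoothLiftChartChangeQuot
import HarnessLib

/-!
# Transport of a lifted atlas along an isomorphism of the scheme being lifted ([Hartshorne2010] Thm. 10.2 (a) proof, Remark 10.2.2;
# [Oort1971] §2.2, Lemma (2.2.4))

Layer `Literature/AlgebraicGeometry/Deformation`, namespace `Literature.AlgebraicGeometry.Deformation.AtlasTransportQuot`.
DEFINITION FILE (cell `hodgecm-mathlib`, P6 sub-desk P6b, deal (vii-d) «ATLAS TRANSPORT ∕ NATURALITY»; count-neutral ★ capital; no instance,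
no notation, no named fact, no `sorry`).  Quotient currency throughout; built on ★ VOCABULARY `SmoothLiftAtlasVocabularyQuot`, ★ (x)
`SmoothLiftChartChangeQuot` and the ring-level half `CanonicalRestrictedLiftBaseChangeQuot`.

THE PRINT. [Hartshorne2010, Thm. 10.2 (a) (proof), p. 81 and Cor. 10.3 (a), p. 82]: there is just ONE obstruction — independent of the local lifts `U'_i`
and of the isomorphisms `φ_{ij}` ([Hartshorne2010, Remark 10.2.2, p. 82]: automorphisms over the identity are `H⁰(X₀, 𝒯⁰ ⊗ J)`, the currency
of readings); [Oort1971, §2.2 (pp. 277–279) and Lemma (2.2.4) (p. 274)]: local lifts are unique up to isomorphism and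
`D(X′; R → R′)` «does not depend on the choices made».  This file is the bookkeeping of the symmetry an AUTOMORPHISM of the scheme being lifted acts
through (consumer of record: (U-ab), «the class is `[-1]`-invariant», [Oort1971] p. 279): an isomorphism `σ : X₀ ⥲ X₀'` compatible with the
`A'`-structures (`hσ`) TRANSPORTS a lifted atlas of `X₀'` (principal affine cover `V'`, equations `c'`, local lifts `r' a : P a ↠ Γ(X₀', V' a)`,
gluings `ψ'`) to a lifted atlas of `X₀` with the SAME charts `P a` — cover `σ⁻¹V'` (`transportCover`), equations `σ♯c'` (`transportEq`), lifts
`σ♯ ∘ r' a` (`transportRed`), gluings `τ_a ≫ ψ' ≫ τ_b⁻¹` (`transportGluing`) — and every derived object of the vocabulary is the original one read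
through two CANONICAL identifications: `τ = chartEquiv` on the chart lifts (localisations of `P a` at submonoids that are equal only
propositionally, `liftSubmonoid_transportRed`) and the GIVEN closed-fibre identifications `s̄` (`s̄ ∘ π' = π ∘ σ♯`, abstract (R8) layers on both
sides; `s̄ := σ_κ♯` for the canonical closed fibres).  The opens need no identification: `σ⁻¹(V'_a ∩ V'_b) ≡ σ⁻¹V'_a ∩ σ⁻¹V'_b` definitionally.

* §2.1 `appₐ` (`σ♯` as `≃ₐ[A']`), `res_app` (naturality).  §2.2 `transportCover`, `transportEq`, `transportRed` with the vocabulary's `hc`, `hr`,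
  `hkr`: `transportCover_inf_eq_basicOpen`, `transportRed_surjective`, `ker_transportRed`; `transport_principal` (principal witnesses transport).
* §2.3 `liftSubmonoid_transportRed`, `chartEquiv` (+ `_algebraMap`, `_symm_algebraMap`), `reduction_chartEquiv` (`red = σ♯ ∘ red' ∘ τ`),
  `restrict_chartEquiv`.
* §2.4 `transportGluing`, `chartEquiv_transportGluing` (`τ_b ∘ ψ = ψ' ∘ τ_a`), `reduction_transportGluing` (the vocabulary's `hψ`),
  **`gluingOn_transport`** (`gluingOn_{σ⁻¹W'} = τ_a ≫ gluingOn'_{W'} ≫ τ_b⁻¹`), **`disc_transport`** (`disc = τ_a ≫ disc' ≫ τ_a⁻¹`, ★ (x)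
  `discrepancy_transport`).
* §2.5 `fibreRed_transport`, **`reading_transport`** (face readings `δ` of the transported atlas and `δ'` of the original satisfy
  `δ (s̄ x) = (s̄ ⊗ 1)(δ' x)`) and the converse **`readingAut_transport`** (the `s̄`-conjugate of `δ'` IS the transported face reading).
NOT HERE: the Čech readback `o ↦ σ_κ^* o'`, `[o] ↦ σ_κ^*[o']` on the closed fibres ((vii-d)-B, with the refinement comparison of (vii-e)).

HC_CM is proved only modulo the printed citations until rung 0 closes; nothing here bears on a summit statement.
## References
* [Hartshorne2010] R. Hartshorne, *Deformation Theory*, GTM 257, Springer (2010): Thm. 10.2 (a) and its proof (p. 81), Cor. 10.3 (a) (p. 82),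
  Remark 10.2.2 (p. 82).
* [Oort1971] F. Oort, *Finite group schemes, local moduli for abelian varieties, and lifting problems*, Compositio Math. 23 (1971), §2.2
  (pp. 277–279), Lemma (2.2.4) (p. 274).
* [StacksProject] The Stacks Project, Tag 00CP (maps out of a localisation), Tag 01I2.
-/

noncomputable section

-- `TopCat.Presheaf`/`TopCat.Sheaf` are not reducible (as in Mathlib's `AlgebraicGeometry/Modules`).
set_option backward.isDefEq.respectTransparency false

open CategoryTheory AlgebraicGeometry Opposite TopologicalSpace
open scoped TensorProduct

universe u

namespace Literature.AlgebraicGeometry.Deformation.AtlasTransportQuot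

open Literature.AlgebraicGeometry.Deformation.CanonicalLiftQuot Literature.AlgebraicGeometry.Deformation.ExtensionAutomorphismsQuot
  Literature.AlgebraicGeometry.Deformation.LiftObstructionCocycleQuot Literature.AlgebraicGeometry.Deformation.LiftGluingSuppliersQuot
  Literature.AlgebraicGeometry.Deformation.LiftLocalizationQuot Literature.AlgebraicGeometry.Deformation.LiftChartChangeQuot
  Literature.AlgebraicGeometry.Deformation.AtlasQuot Literature.AlgebraicGeometry.Deformation.CanonicalLiftBaseChangeQuot

/-! ## §2 Scheme level: the transported atlas along `σ : X₀ ⥲ X₀'` -/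

section SchemeLevel

variable {A' : Type u} [CommRing A'] {X₀ X₀' : Scheme.{u}} [instΓ : ∀ W : X₀.Opens, Algebra A' Γ(X₀, W)]
  [instΓ' : ∀ W' : X₀'.Opens, Algebra A' Γ(X₀', W')]
  (halg : ∀ (W V : X₀.Opens) (e : V ≤ W) (a : A'), X₀.presheaf.map (homOfLE e).op (algebraMap A' Γ(X₀, W) a) = algebraMap A' Γ(X₀, V) a)
  (halg' : ∀ (W V : X₀'.Opens) (e : V ≤ W) (a : A'), X₀'.presheaf.map (homOfLE e).op (algebraMap A' Γ(X₀', W) a) = algebraMap A' Γ(X₀', V) a)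
  (σ : X₀ ⟶ X₀') [IsIso σ]
  (hσ : ∀ (W' : X₀'.Opens) (a : A'), σ.app W' (algebraMap A' Γ(X₀', W') a) = algebraMap A' Γ(X₀, σ ⁻¹ᵁ W') a)

/-! ### §2.1 `σ♯` on an open as an `A'`-algebra isomorphism, and its naturality -/

/-- `σ♯_{W'} : Γ(X₀', W') ≃ₐ[A'] Γ(X₀, σ⁻¹W')` (an isomorphism of schemes is one on sections; `A'`-linear by `hσ`).
[cite: Hartshorne2010, Thm. 10.2 (a) (proof), p. 81] -/
def appₐ (W' : X₀'.Opens) : Γ(X₀', W') ≃ₐ[A'] Γ(X₀, σ ⁻¹ᵁ W') :=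
  AlgEquiv.ofRingEquiv (f := (asIso (σ.app W')).commRingCatIsoToRingEquiv) (hσ W')

/-- `appₐ` acts as `σ♯`. [cite: Hartshorne2010, Thm. 10.2 (a) (proof), p. 81] -/
theorem appₐ_apply (W' : X₀'.Opens) (x : Γ(X₀', W')) : appₐ σ hσ W' x = σ.app W' x := rfl

omit instΓ instΓ' [IsIso σ] in
/-- Naturality of `σ♯` under restriction: `(σ♯ x)|_{σ⁻¹W'} = σ♯ (x|_{W'})`. [cite: StacksProject, Tag 01I2] -/
theorem res_app {U' W' : X₀'.Opens} (h : W' ≤ U') (x : Γ(X₀', U')) :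
    res (σ.preimage_mono h) (σ.app U' x) = σ.app W' (res h x) := by
  change (σ.app U' ≫ X₀.presheaf.map (homOfLE (σ.preimage_mono h)).op) x = (X₀'.presheaf.map (homOfLE h).op ≫ σ.app W') x
  rw [σ.naturality (homOfLE h).op]
  rfl

/-! ### §2.2 The transported cover, equations and local lifts -/

variable {J : Ideal A'} (hJ : IsNilpotent J) {ι : Type*} (V' : ι → X₀'.affineOpens) (c' : (a b : ι) → Γ(X₀', (V' a).1))
  (hc' : ∀ a b, (V' a).1 ⊓ (V' b).1 = X₀'.basicOpen (c' a b))
  {P : ι → Type u} [∀ a, CommRing (P a)] [∀ a, Algebra A' (P a)]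
  (r' : (a : ι) → P a →ₐ[A'] Γ(X₀', (V' a).1)) (hr' : ∀ a, Function.Surjective (r' a))
  (hkr' : ∀ a, RingHom.ker (r' a) = J.map (algebraMap A' (P a)))

/-- **The transported cover** `a ↦ σ⁻¹ V'_a` (affine: preimage of an affine open under an isomorphism). [cite: Hartshorne2010, Thm. 10.2 (a) (proof), p. 81] -/
abbrev transportCover : ι → X₀.affineOpens := fun a => ⟨σ ⁻¹ᵁ (V' a).1, (V' a).2.preimage_of_isIso σ⟩

/-- **The transported equations** `σ♯ c'_{ab}`. [cite: Hartshorne2010, Thm. 10.2 (a) (proof), p. 81] -/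
abbrev transportEq : (a b : ι) → Γ(X₀, (transportCover σ V' a).1) := fun a b => σ.app (V' a).1 (c' a b)

omit instΓ instΓ' in
include hc' in
/-- The transported cover is principal with the transported equations: `σ⁻¹V'_a ⊓ σ⁻¹V'_b = D(σ♯ c'_{ab})`. [cite: StacksProject, Tag 01I2] -/
theorem transportCover_inf_eq_basicOpen (a b : ι) :
    (transportCover σ V' a).1 ⊓ (transportCover σ V' b).1 = X₀.basicOpen (transportEq σ V' c' a b) := by
  change σ ⁻¹ᵁ (V' a).1 ⊓ σ ⁻¹ᵁ (V' b).1 = X₀.basicOpen (σ.app (V' a).1 (c' a b))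
  rw [← Scheme.preimage_basicOpen, ← hc']
  rfl

/-- **The transported local lifts** `σ♯ ∘ r'_a : P_a ↠ Γ(X₀, σ⁻¹V'_a)` (same charts `P_a`). [cite: Oort1971, Lemma (2.2.4) (p. 274)]
[cite: Hartshorne2010, Thm. 10.2 (a) (proof), p. 81] -/
abbrev transportRed : (a : ι) → P a →ₐ[A'] Γ(X₀, (transportCover σ V' a).1) :=
  fun a => (appₐ σ hσ (V' a).1 : Γ(X₀', (V' a).1) →ₐ[A'] Γ(X₀, σ ⁻¹ᵁ (V' a).1)).comp (r' a)

include hr' in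
/-- The transported lifts are onto. [cite: Hartshorne2010, Thm. 10.2 (a) (proof), p. 81] -/
theorem transportRed_surjective (a : ι) : Function.Surjective (transportRed σ hσ V' r' a) :=
  (appₐ σ hσ (V' a).1).surjective.comp (hr' a)

include hkr' in
/-- The transported lifts have kernel `J · P_a`. [cite: Hartshorne2010, Thm. 10.2 (a) (proof), p. 81] -/
theorem ker_transportRed (a : ι) : RingHom.ker (transportRed σ hσ V' r' a) = J.map (algebraMap A' (P a)) := by
  rw [← hkr' a]
  ext p
  simp only [RingHom.mem_ker]
  change appₐ σ hσ (V' a).1 (r' a p) = 0 ↔ r' a p = 0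
  exact map_eq_zero_iff _ (appₐ σ hσ (V' a).1).injective


omit instΓ instΓ' in
/-- **Principal witnesses transport:** a principal open `W' = D(q)` of the chart `V'_a` pulls back to the principal open `σ⁻¹W' = D(σ♯q)` of
`σ⁻¹V'_a` — the witnesses `pa`, `pb` the vocabulary's `gluingOn` asks for on the transported side. [cite: StacksProject, Tag 01I2] -/
theorem transport_principal (a : ι) {W' : X₀'.Opens} (pa' : ∃ q : Γ(X₀', (V' a).1), W' = X₀'.basicOpen q) :
    ∃ q : Γ(X₀, (transportCover σ V' a).1), σ ⁻¹ᵁ W' = X₀.basicOpen q := by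
  obtain ⟨q, rfl⟩ := pa'
  exact ⟨σ.app (V' a).1 q, Scheme.preimage_basicOpen σ q⟩

/-! ### §2.3 The chart-lift identification `τ` -/

/-- The chart lifts of the transported atlas and of the original one are localisations of `P_a` at the same submonoid.
[cite: Oort1971, Lemma (2.2.4) (p. 274)] -/
theorem liftSubmonoid_transportRed (a : ι) {W' : X₀'.Opens} (h' : W' ≤ (V' a).1) :
    liftSubmonoid (transportRed σ hσ V' r' a) (res (σ.preimage_mono h')) = liftSubmonoid (r' a) (res h') :=
  liftSubmonoid_comp_algEquiv (r' a) (appₐ σ hσ (V' a).1) (res h') (res (σ.preimage_mono h'))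
    (asIso (σ.app W')).commRingCatIsoToRingEquiv fun q => res_app σ h' q

/-- `IsLocalization` form of the previous lemma (the instance the identification is built from). [cite: StacksProject, Tag 00CP] -/
theorem isLocalization_chartLift_transport (a : ι) {W' : X₀'.Opens} (h' : W' ≤ (V' a).1) :
    IsLocalization (liftSubmonoid (r' a) (res h')) (chartLift (transportCover σ V') (transportRed σ hσ V' r') a (σ.preimage_mono h')) := by
  rw [← liftSubmonoid_transportRed σ hσ V' r' a h']
  exact Localization.isLocalization

/-- **The chart-lift identification** `τ_a(W') : L(σ♯ ∘ r'_a, res_{σ⁻¹W'}) ≃ₐ[A'] L(r'_a, res_{W'})` — the canonical `P_a`-algebra isomorphism of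
two localisations at the same submonoid. [cite: Oort1971, Lemma (2.2.4) (p. 274)] [cite: StacksProject, Tag 00CP] -/
def chartEquiv (a : ι) {W' : X₀'.Opens} (h' : W' ≤ (V' a).1) :
    chartLift (transportCover σ V') (transportRed σ hσ V' r') a (σ.preimage_mono h') ≃ₐ[A'] chartLift V' r' a h' :=
  haveI := isLocalization_chartLift_transport σ hσ V' r' a h'
  ((IsLocalization.algEquiv (liftSubmonoid (r' a) (res h'))
      (chartLift (transportCover σ V') (transportRed σ hσ V' r') a (σ.preimage_mono h')) (chartLift V' r' a h')).restrictScalars A')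

/-- `τ` is over `P_a`. [cite: StacksProject, Tag 00CP] -/
theorem chartEquiv_algebraMap (a : ι) {W' : X₀'.Opens} (h' : W' ≤ (V' a).1) (p : P a) :
    chartEquiv σ hσ V' r' a h' (algebraMap (P a) _ p) = algebraMap (P a) _ p := by
  haveI := isLocalization_chartLift_transport σ hσ V' r' a h'
  exact (IsLocalization.algEquiv (liftSubmonoid (r' a) (res h'))
    (chartLift (transportCover σ V') (transportRed σ hσ V' r') a (σ.preimage_mono h')) (chartLift V' r' a h')).commutes p

/-- `τ⁻¹` is over `P_a`. [cite: StacksProject, Tag 00CP] -/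
theorem chartEquiv_symm_algebraMap (a : ι) {W' : X₀'.Opens} (h' : W' ≤ (V' a).1) (p : P a) :
    (chartEquiv σ hσ V' r' a h').symm (algebraMap (P a) _ p) = algebraMap (P a) _ p :=
  (chartEquiv σ hσ V' r' a h').injective (by rw [AlgEquiv.apply_symm_apply, chartEquiv_algebraMap])

include halg halg' in
/-- **`τ` is compatible with the canonical reductions:** `red (y) = σ♯ (red' (τ y))`. [cite: Hartshorne2010, Thm. 10.2 (a) (proof), p. 81] -/
theorem reduction_chartEquiv (a : ι) {W' : X₀'.Opens} (h' : W' ≤ (V' a).1)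
    (y : chartLift (transportCover σ V') (transportRed σ hσ V' r') a (σ.preimage_mono h')) :
    reduction (transportRed σ hσ V' r' a) (res (σ.preimage_mono h')) (halg _ _ _) y =
      σ.app W' (reduction (r' a) (res h') (halg' _ _ _) (chartEquiv σ hσ V' r' a h' y)) :=
  reduction_transportEquiv (r' a) (appₐ σ hσ (V' a).1) (res h') (res (σ.preimage_mono h'))
    (asIso (σ.app W')).commRingCatIsoToRingEquiv (fun q => res_app σ h' q) (halg _ _ _) (halg' _ _ _)
    (chartEquiv σ hσ V' r' a h') (chartEquiv_algebraMap σ hσ V' r' a h') y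

/-- **`τ` is compatible with the canonical restrictions** to a deeper open `W'' ≤ W'`. [cite: Hartshorne2010, Thm. 10.2 (a) (proof), p. 81]
[cite: StacksProject, Tag 00CP] -/
theorem restrict_chartEquiv (a : ι) {W' W'' : X₀'.Opens} (h' : W' ≤ (V' a).1) (h'' : W'' ≤ (V' a).1) (hW : W'' ≤ W')
    (y : chartLift (transportCover σ V') (transportRed σ hσ V' r') a (σ.preimage_mono h')) :
    chartEquiv σ hσ V' r' a h''
        (restrict (transportRed σ hσ V' r' a) (res (σ.preimage_mono h')) (res (σ.preimage_mono h''))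
          (liftSubmonoid_mono _ _ _ (res (σ.preimage_mono hW)) fun q => res_res (σ.preimage_mono h') (σ.preimage_mono hW) q) y) =
      restrict (r' a) (res h') (res h'') (liftSubmonoid_mono _ _ _ (res hW) fun q => res_res h' hW q)
        (chartEquiv σ hσ V' r' a h' y) :=
  restrict_transportEquiv (r' a) (appₐ σ hσ (V' a).1) (res h') (res (σ.preimage_mono h')) (res h'') (res (σ.preimage_mono h''))
    _ _ (chartEquiv σ hσ V' r' a h') (chartEquiv_algebraMap σ hσ V' r' a h') (chartEquiv σ hσ V' r' a h'')
    (chartEquiv_algebraMap σ hσ V' r' a h'') y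

/-! ### §2.4 The transported gluings and the conjugation formulas -/

variable (ψ' : (a b : ι) → chartLift V' r' a (inf_le_left : (V' a).1 ⊓ (V' b).1 ≤ (V' a).1) ≃ₐ[A']
    chartLift V' r' b (inf_le_right : (V' a).1 ⊓ (V' b).1 ≤ (V' b).1))
  (hψ' : ∀ a b x, reduction (r' b) (res (inf_le_right : (V' a).1 ⊓ (V' b).1 ≤ (V' b).1)) (halg' _ _ _) (ψ' a b x) =
    reduction (r' a) (res (inf_le_left : (V' a).1 ⊓ (V' b).1 ≤ (V' a).1)) (halg' _ _ _) x)

/-- **The transported gluings** `τ_a ≫ ψ'_{ab} ≫ τ_b⁻¹` on `σ⁻¹V'_a ⊓ σ⁻¹V'_b = σ⁻¹(V'_a ⊓ V'_b)`.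
[cite: Hartshorne2010, Thm. 10.2 (a) (proof), p. 81] [cite: Oort1971, §2.2 (pp. 277–279)] -/
def transportGluing (a b : ι) :
    chartLift (transportCover σ V') (transportRed σ hσ V' r') a
        (inf_le_left : (transportCover σ V' a).1 ⊓ (transportCover σ V' b).1 ≤ (transportCover σ V' a).1) ≃ₐ[A']
      chartLift (transportCover σ V') (transportRed σ hσ V' r') b
        (inf_le_right : (transportCover σ V' a).1 ⊓ (transportCover σ V' b).1 ≤ (transportCover σ V' b).1) :=
  (chartEquiv σ hσ V' r' a (inf_le_left : (V' a).1 ⊓ (V' b).1 ≤ (V' a).1)).trans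
    ((ψ' a b).trans (chartEquiv σ hσ V' r' b (inf_le_right : (V' a).1 ⊓ (V' b).1 ≤ (V' b).1)).symm)

/-- `τ_b ∘ ψ_{ab} = ψ'_{ab} ∘ τ_a` (the identifications INTERTWINE the gluings — the `cᵢⱼ` of ★ (x) `discrepancy_transport`).
[cite: Hartshorne2010, Remark 10.2.2, p. 82] -/
theorem chartEquiv_transportGluing (a b : ι)
    (x : chartLift (transportCover σ V') (transportRed σ hσ V' r') a
      (inf_le_left : (transportCover σ V' a).1 ⊓ (transportCover σ V' b).1 ≤ (transportCover σ V' a).1)) :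
    chartEquiv σ hσ V' r' b (inf_le_right : (V' a).1 ⊓ (V' b).1 ≤ (V' b).1) (transportGluing σ hσ V' r' ψ' a b x) =
      ψ' a b (chartEquiv σ hσ V' r' a (inf_le_left : (V' a).1 ⊓ (V' b).1 ≤ (V' a).1) x) :=
  AlgEquiv.apply_symm_apply _ _

include hψ' in
/-- **The transported gluings are reduction-compatible** (the vocabulary's `hψ` for the transported atlas).
[cite: Hartshorne2010, Thm. 10.2 (a) (proof), p. 81] -/
theorem reduction_transportGluing (a b : ι)
    (x : chartLift (transportCover σ V') (transportRed σ hσ V' r') a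
      (inf_le_left : (transportCover σ V' a).1 ⊓ (transportCover σ V' b).1 ≤ (transportCover σ V' a).1)) :
    reduction (transportRed σ hσ V' r' b)
        (res (inf_le_right : (transportCover σ V' a).1 ⊓ (transportCover σ V' b).1 ≤ (transportCover σ V' b).1)) (halg _ _ _)
        (transportGluing σ hσ V' r' ψ' a b x) =
      reduction (transportRed σ hσ V' r' a)
        (res (inf_le_left : (transportCover σ V' a).1 ⊓ (transportCover σ V' b).1 ≤ (transportCover σ V' a).1)) (halg _ _ _) x := by
  have h1 := reduction_chartEquiv halg halg' σ hσ V' r' b (inf_le_right : (V' a).1 ⊓ (V' b).1 ≤ (V' b).1)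
    (transportGluing σ hσ V' r' ψ' a b x)
  have h2 := reduction_chartEquiv halg halg' σ hσ V' r' a (inf_le_left : (V' a).1 ⊓ (V' b).1 ≤ (V' a).1) x
  rw [chartEquiv_transportGluing, hψ'] at h1
  exact h1.trans h2.symm

include hr' hkr' hψ' in
/-- **The restricted gluings transport by conjugation:** on `σ⁻¹W'` (`W' ⊆ V'_a ∩ V'_b` principal on both charts),
`gluingOn_{σ⁻¹W'} = τ_a ≫ gluingOn'_{W'} ≫ τ_b⁻¹` (★ (U-can) `gluingRestrict_unique` through `restrict_chartEquiv`).
[cite: Hartshorne2010, Thm. 10.2 (a) (proof), p. 81] [cite: StacksProject, Tag 00CP] -/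
theorem gluingOn_transport (a b : ι) (W' : X₀'.Opens) (ha' : W' ≤ (V' a).1) (hb' : W' ≤ (V' b).1)
    (pa' : ∃ q : Γ(X₀', (V' a).1), W' = X₀'.basicOpen q) (pb' : ∃ q : Γ(X₀', (V' b).1), W' = X₀'.basicOpen q)
    (pa : ∃ q : Γ(X₀, (transportCover σ V' a).1), σ ⁻¹ᵁ W' = X₀.basicOpen q)
    (pb : ∃ q : Γ(X₀, (transportCover σ V' b).1), σ ⁻¹ᵁ W' = X₀.basicOpen q) :
    gluingOn halg hJ (transportCover σ V') (transportRed σ hσ V' r') (transportRed_surjective σ hσ V' r' hr')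
        (ker_transportRed σ hσ V' r' hkr') (transportGluing σ hσ V' r' ψ') (reduction_transportGluing halg halg' σ hσ V' r' ψ' hψ')
        a b (σ ⁻¹ᵁ W') (σ.preimage_mono ha') (σ.preimage_mono hb') pa pb =
      (chartEquiv σ hσ V' r' a ha').trans
        ((gluingOn halg' hJ V' r' hr' hkr' ψ' hψ' a b W' ha' hb' pa' pb').trans (chartEquiv σ hσ V' r' b hb').symm) := by
  apply AlgEquiv.coe_toAlgHom_injective
  refine algHom_ext_of_isLocalization (liftSubmonoid (transportRed σ hσ V' r' a) (res (σ.preimage_mono ha'))) _ _ fun p => ?_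
  rw [AlgEquiv.coe_toAlgHom, AlgEquiv.coe_toAlgHom, AlgEquiv.trans_apply, AlgEquiv.trans_apply]
  -- the left-hand side on `p/1`: `ψ|_{σ⁻¹W'} (p/1) = (ψ (p/1))|`
  have hL := gluingOn_restrict halg hJ (transportCover σ V') (transportRed σ hσ V' r') (transportRed_surjective σ hσ V' r' hr')
    (ker_transportRed σ hσ V' r' hkr') (transportGluing σ hσ V' r' ψ') (reduction_transportGluing halg halg' σ hσ V' r' ψ' hψ')
    a b (σ ⁻¹ᵁ W') (σ.preimage_mono ha') (σ.preimage_mono hb') pa pb (algebraMap (P a) _ p)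
  rw [restrict_algebraMap] at hL
  -- the right-hand side on `p/1`
  have hR := gluingOn_restrict halg' hJ V' r' hr' hkr' ψ' hψ' a b W' ha' hb' pa' pb' (algebraMap (P a) _ p)
  rw [restrict_algebraMap] at hR
  rw [hL, chartEquiv_algebraMap, hR, AlgEquiv.eq_symm_apply]
  have hτ := restrict_chartEquiv σ hσ V' r' b (inf_le_right : (V' a).1 ⊓ (V' b).1 ≤ (V' b).1) hb' (le_inf ha' hb')
    (transportGluing σ hσ V' r' ψ' a b (algebraMap (P a) _ p))
  rw [chartEquiv_transportGluing, chartEquiv_algebraMap] at hτ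
  exact hτ

include hψ' in
/-- **THE TRIPLE DISCREPANCY TRANSPORTS BY CONJUGATION:** `disc_{abd} = τ_a ≫ disc'_{abd} ≫ τ_a⁻¹` on `σ⁻¹(V'_a ∩ V'_b ∩ V'_d)`
(★ (x) `discrepancy_transport` with `θᵢ := τᵢ`). [cite: Hartshorne2010, Remark 10.2.2, p. 82] [cite: Oort1971, §2.2 (pp. 277–279)] -/
theorem disc_transport (a b d : ι) :
    disc halg hJ (transportCover σ V') (transportEq σ V' c') (transportCover_inf_eq_basicOpen σ V' c' hc') (transportRed σ hσ V' r')
        (transportRed_surjective σ hσ V' r' hr') (ker_transportRed σ hσ V' r' hkr') (transportGluing σ hσ V' r' ψ')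
        (reduction_transportGluing halg halg' σ hσ V' r' ψ' hψ') a b d =
      (chartEquiv σ hσ V' r' a (inf_le_left.trans inf_le_left : (V' a).1 ⊓ (V' b).1 ⊓ (V' d).1 ≤ (V' a).1)).trans
        ((disc halg' hJ V' c' hc' r' hr' hkr' ψ' hψ' a b d).trans
          (chartEquiv σ hσ V' r' a (inf_le_left.trans inf_le_left : (V' a).1 ⊓ (V' b).1 ⊓ (V' d).1 ≤ (V' a).1)).symm) := by
  -- the three chart-lift identifications on the triple overlap intertwine the three restricted gluings
  have c₁₂ := fun x => (congrArg (fun e : _ ≃ₐ[A'] _ => chartEquiv σ hσ V' r' b (inf_le_left.trans inf_le_right) (e x))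
    (gluingOn_transport halg halg' σ hσ hJ V' r' hr' hkr' ψ' hψ' a b ((V' a).1 ⊓ (V' b).1 ⊓ (V' d).1)
      (inf_le_left.trans inf_le_left) (inf_le_left.trans inf_le_right) ⟨_, inf₃_eq_basicOpen₁ V' c' hc' a b d⟩
      ⟨_, inf₃_eq_basicOpen₂ V' c' hc' a b d⟩
      ⟨_, inf₃_eq_basicOpen₁ (transportCover σ V') (transportEq σ V' c') (transportCover_inf_eq_basicOpen σ V' c' hc') a b d⟩
      ⟨_, inf₃_eq_basicOpen₂ (transportCover σ V') (transportEq σ V' c') (transportCover_inf_eq_basicOpen σ V' c' hc') a b d⟩)).trans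
    (by rw [AlgEquiv.trans_apply, AlgEquiv.trans_apply, AlgEquiv.apply_symm_apply])
  have c₂₃ := fun x => (congrArg (fun e : _ ≃ₐ[A'] _ => chartEquiv σ hσ V' r' d inf_le_right (e x))
    (gluingOn_transport halg halg' σ hσ hJ V' r' hr' hkr' ψ' hψ' b d ((V' a).1 ⊓ (V' b).1 ⊓ (V' d).1)
      (inf_le_left.trans inf_le_right) inf_le_right ⟨_, inf₃_eq_basicOpen₂ V' c' hc' a b d⟩
      ⟨_, inf₃_eq_basicOpen₃ V' c' hc' a b d⟩
      ⟨_, inf₃_eq_basicOpen₂ (transportCover σ V') (transportEq σ V' c') (transportCover_inf_eq_basicOpen σ V' c' hc') a b d⟩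
      ⟨_, inf₃_eq_basicOpen₃ (transportCover σ V') (transportEq σ V' c') (transportCover_inf_eq_basicOpen σ V' c' hc') a b d⟩)).trans
    (by rw [AlgEquiv.trans_apply, AlgEquiv.trans_apply, AlgEquiv.apply_symm_apply])
  have c₁₃ := fun x => (congrArg (fun e : _ ≃ₐ[A'] _ => chartEquiv σ hσ V' r' d inf_le_right (e x))
    (gluingOn_transport halg halg' σ hσ hJ V' r' hr' hkr' ψ' hψ' a d ((V' a).1 ⊓ (V' b).1 ⊓ (V' d).1)
      (inf_le_left.trans inf_le_left) inf_le_right ⟨_, inf₃_eq_basicOpen₁ V' c' hc' a b d⟩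
      ⟨_, inf₃_eq_basicOpen₃ V' c' hc' a b d⟩
      ⟨_, inf₃_eq_basicOpen₁ (transportCover σ V') (transportEq σ V' c') (transportCover_inf_eq_basicOpen σ V' c' hc') a b d⟩
      ⟨_, inf₃_eq_basicOpen₃ (transportCover σ V') (transportEq σ V' c') (transportCover_inf_eq_basicOpen σ V' c' hc') a b d⟩)).trans
    (by rw [AlgEquiv.trans_apply, AlgEquiv.trans_apply, AlgEquiv.apply_symm_apply])
  have key : disc halg' hJ V' c' hc' r' hr' hkr' ψ' hψ' a b d =
      (chartEquiv σ hσ V' r' a (inf_le_left.trans inf_le_left : (V' a).1 ⊓ (V' b).1 ⊓ (V' d).1 ≤ (V' a).1)).symm.trans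
        ((disc halg hJ (transportCover σ V') (transportEq σ V' c') (transportCover_inf_eq_basicOpen σ V' c' hc')
            (transportRed σ hσ V' r') (transportRed_surjective σ hσ V' r' hr') (ker_transportRed σ hσ V' r' hkr')
            (transportGluing σ hσ V' r' ψ') (reduction_transportGluing halg halg' σ hσ V' r' ψ' hψ') a b d).trans
          (chartEquiv σ hσ V' r' a (inf_le_left.trans inf_le_left : (V' a).1 ⊓ (V' b).1 ⊓ (V' d).1 ≤ (V' a).1))) :=
    discrepancy_transport _ _ _ c₁₂ c₂₃ c₁₃
  rw [key]
  ext y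
  simp only [AlgEquiv.trans_apply, AlgEquiv.symm_apply_apply]

/-! ### §2.5 The closed-fibre layers and the readings -/

variable (𝔪 : Ideal A')
  {B : X₀.Opens → Type u} [∀ W, CommRing (B W)] [∀ W, Algebra A' (B W)] (π : (W : X₀.Opens) → Γ(X₀, W) →ₐ[A'] B W)
  (hπ : ∀ (a : ι) (W : X₀.Opens), W ≤ (transportCover σ V' a).1 → (∃ q : Γ(X₀, (transportCover σ V' a).1), W = X₀.basicOpen q) →
    Function.Surjective (π W) ∧ RingHom.ker (π W) = 𝔪.map (algebraMap A' Γ(X₀, W)))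
  {B' : X₀'.Opens → Type u} [∀ W', CommRing (B' W')] [∀ W', Algebra A' (B' W')] (π' : (W' : X₀'.Opens) → Γ(X₀', W') →ₐ[A'] B' W')
  (hπ' : ∀ (a : ι) (W' : X₀'.Opens), W' ≤ (V' a).1 → (∃ q : Γ(X₀', (V' a).1), W' = X₀'.basicOpen q) →
    Function.Surjective (π' W') ∧ RingHom.ker (π' W') = 𝔪.map (algebraMap A' Γ(X₀', W')))
  -- the closed-fibre identifications induced by `σ` (e.g. `σ_κ♯` for the canonical closed fibres)
  (sbar : (W' : X₀'.Opens) → B' W' ≃ₐ[A'] B (σ ⁻¹ᵁ W'))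
  (hsbar : ∀ (W' : X₀'.Opens) (x : Γ(X₀', W')), sbar W' (π' W' x) = π (σ ⁻¹ᵁ W') (σ.app W' x))

include halg' hsbar in
/-- **The closed-fibre reductions transport:** `fibreRed (y) = s̄ (fibreRed' (τ y))`. [cite: Hartshorne2010, Thm. 10.2 (a) (proof), p. 81] -/
theorem fibreRed_transport (a : ι) {W' : X₀'.Opens} (h' : W' ≤ (V' a).1)
    (y : chartLift (transportCover σ V') (transportRed σ hσ V' r') a (σ.preimage_mono h')) :
    fibreRed halg (transportCover σ V') (transportRed σ hσ V' r') π a (σ.preimage_mono h') y =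
      sbar W' (fibreRed halg' V' r' π' a h' (chartEquiv σ hσ V' r' a h' y)) := by
  change π _ (reduction _ _ _ y) = sbar W' (π' W' (reduction _ _ _ _))
  rw [reduction_chartEquiv halg halg' σ hσ V' r' a h' y, hsbar]

include hsbar in
/-- **THE FACE READINGS TRANSPORT BY `s̄`-CONJUGATION.**  If `δ'` is the face reading of the original atlas on `V'_a ∩ V'_b ∩ V'_d`
(`readingAut' δ' = disc'`) and `δ` that of the transported atlas on `σ⁻¹(V'_a ∩ V'_b ∩ V'_d)` (`readingAut δ = disc`), then
`δ (s̄ x) = (s̄ ⊗ 1) (δ' x)` (★ (c4) `reading_naturality` along `τ_a⁻¹` over `s̄`, intertwining by `disc_transport`).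
[cite: Hartshorne2010, Remark 10.2.2, p. 82] [cite: Oort1971, §2.2 (pp. 277–279)] -/
theorem reading_transport (h𝔪J : 𝔪 * J = ⊥) (hJ𝔪 : J ≤ 𝔪) [∀ a, Module.Flat A' (P a)] (a b d : ι)
    {δ' : Derivation A' (B' ((V' a).1 ⊓ (V' b).1 ⊓ (V' d).1)) (B' ((V' a).1 ⊓ (V' b).1 ⊓ (V' d).1) ⊗[A'] ↥J)}
    (hδ' : readingAut halg' hJ V' r' hr' hkr' 𝔪 π' hπ' h𝔪J hJ𝔪 a (inf_le_left.trans inf_le_left)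
        ⟨_, inf₃_eq_basicOpen₁ V' c' hc' a b d⟩ δ' = disc halg' hJ V' c' hc' r' hr' hkr' ψ' hψ' a b d)
    {δ : Derivation A' (B (σ ⁻¹ᵁ ((V' a).1 ⊓ (V' b).1 ⊓ (V' d).1))) (B (σ ⁻¹ᵁ ((V' a).1 ⊓ (V' b).1 ⊓ (V' d).1)) ⊗[A'] ↥J)}
    (hδ : readingAut halg hJ (transportCover σ V') (transportRed σ hσ V' r') (transportRed_surjective σ hσ V' r' hr')
        (ker_transportRed σ hσ V' r' hkr') 𝔪 π hπ h𝔪J hJ𝔪 a (inf_le_left.trans inf_le_left)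
        ⟨_, inf₃_eq_basicOpen₁ (transportCover σ V') (transportEq σ V' c') (transportCover_inf_eq_basicOpen σ V' c' hc') a b d⟩ δ =
      disc halg hJ (transportCover σ V') (transportEq σ V' c') (transportCover_inf_eq_basicOpen σ V' c' hc') (transportRed σ hσ V' r')
        (transportRed_surjective σ hσ V' r' hr') (ker_transportRed σ hσ V' r' hkr') (transportGluing σ hσ V' r' ψ')
        (reduction_transportGluing halg halg' σ hσ V' r' ψ' hψ') a b d)
    (x : B' ((V' a).1 ⊓ (V' b).1 ⊓ (V' d).1)) :
    δ (sbar _ x) = LinearMap.rTensor ↥J (sbar ((V' a).1 ⊓ (V' b).1 ⊓ (V' d).1)).toLinearMap (δ' x) := by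
  haveI := CanonicalLiftQuot.flat (r' a) (res (inf_le_left.trans inf_le_left : (V' a).1 ⊓ (V' b).1 ⊓ (V' d).1 ≤ (V' a).1))
  haveI := CanonicalLiftQuot.flat (transportRed σ hσ V' r' a)
    (res (σ.preimage_mono (inf_le_left.trans inf_le_left : (V' a).1 ⊓ (V' b).1 ⊓ (V' d).1 ≤ (V' a).1)))
  exact reading_of_conj 𝔪 J h𝔪J hJ𝔪 _ _ _ _ _ _
    (chartEquiv σ hσ V' r' a (inf_le_left.trans inf_le_left : (V' a).1 ⊓ (V' b).1 ⊓ (V' d).1 ≤ (V' a).1)) (sbar _)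
    (fun y => (fibreRed_transport halg halg' σ hσ V' r' π π' sbar hsbar a _ _).trans (by rw [AlgEquiv.apply_symm_apply]))
    (disc_transport halg halg' σ hσ hJ V' c' hc' r' hr' hkr' ψ' hψ' a b d) hδ hδ' x

include hsbar in
/-- **Converse: the `s̄`-conjugate of the original face reading IS the face reading of the transported atlas** — any `δ` with
`δ (s̄ x) = (s̄ ⊗ 1)(δ' x)` has `readingAut δ = disc` (★ `comp_autOfClosedFibreDerivation_iff` + `disc_transport`): the transported atlas's
readings, cochain and class are the original ones read through `s̄`. [cite: Hartshorne2010, Remark 10.2.2, p. 82] [cite: Oort1971, §2.2 (pp. 277–279)] -/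
theorem readingAut_transport (h𝔪J : 𝔪 * J = ⊥) (hJ𝔪 : J ≤ 𝔪) [∀ a, Module.Flat A' (P a)] (a b d : ι)
    {δ' : Derivation A' (B' ((V' a).1 ⊓ (V' b).1 ⊓ (V' d).1)) (B' ((V' a).1 ⊓ (V' b).1 ⊓ (V' d).1) ⊗[A'] ↥J)}
    (hδ' : readingAut halg' hJ V' r' hr' hkr' 𝔪 π' hπ' h𝔪J hJ𝔪 a (inf_le_left.trans inf_le_left)
        ⟨_, inf₃_eq_basicOpen₁ V' c' hc' a b d⟩ δ' = disc halg' hJ V' c' hc' r' hr' hkr' ψ' hψ' a b d)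
    {δ : Derivation A' (B (σ ⁻¹ᵁ ((V' a).1 ⊓ (V' b).1 ⊓ (V' d).1))) (B (σ ⁻¹ᵁ ((V' a).1 ⊓ (V' b).1 ⊓ (V' d).1)) ⊗[A'] ↥J)}
    (hδδ' : ∀ x, δ (sbar _ x) = LinearMap.rTensor ↥J (sbar ((V' a).1 ⊓ (V' b).1 ⊓ (V' d).1)).toLinearMap (δ' x)) :
    readingAut halg hJ (transportCover σ V') (transportRed σ hσ V' r') (transportRed_surjective σ hσ V' r' hr')
        (ker_transportRed σ hσ V' r' hkr') 𝔪 π hπ h𝔪J hJ𝔪 a (inf_le_left.trans inf_le_left)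
        ⟨_, inf₃_eq_basicOpen₁ (transportCover σ V') (transportEq σ V' c') (transportCover_inf_eq_basicOpen σ V' c' hc') a b d⟩ δ =
      disc halg hJ (transportCover σ V') (transportEq σ V' c') (transportCover_inf_eq_basicOpen σ V' c' hc') (transportRed σ hσ V' r')
        (transportRed_surjective σ hσ V' r' hr') (ker_transportRed σ hσ V' r' hkr') (transportGluing σ hσ V' r' ψ')
        (reduction_transportGluing halg halg' σ hσ V' r' ψ' hψ') a b d := by
  haveI := CanonicalLiftQuot.flat (r' a) (res (inf_le_left.trans inf_le_left : (V' a).1 ⊓ (V' b).1 ⊓ (V' d).1 ≤ (V' a).1))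
  haveI := CanonicalLiftQuot.flat (transportRed σ hσ V' r' a)
    (res (σ.preimage_mono (inf_le_left.trans inf_le_left : (V' a).1 ⊓ (V' b).1 ⊓ (V' d).1 ≤ (V' a).1)))
  rw [disc_transport halg halg' σ hσ hJ V' c' hc' r' hr' hkr' ψ' hψ' a b d]
  exact autOfClosedFibreDerivation_of_conj 𝔪 J h𝔪J hJ𝔪 _ _ _ _ _ _
    (chartEquiv σ hσ V' r' a (inf_le_left.trans inf_le_left : (V' a).1 ⊓ (V' b).1 ⊓ (V' d).1 ≤ (V' a).1)) (sbar _)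
    (fun y => (fibreRed_transport halg halg' σ hσ V' r' π π' sbar hsbar a _ _).trans (by rw [AlgEquiv.apply_symm_apply]))
    hδδ' hδ'

end SchemeLevel
end Literature.AlgebraicGeometry.Deformation.AtlasTransportQuot

end
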